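import Summits.KontsevichZagierPeriods.KontsevichZagierPeriods.Theorems.FurushoPentagonPentagonInKZCornersCubicalAlgA

/-!
# `PentagonInKZ` (stmt-KontsevichZagierPeriods-11348), line `edge-normal-newton-leibniz`:
# stub `stub_cornersBlowup` — algebra of the two blow-up corner charts (aux)

The two remaining vertices of the pentagon cell `{0 < x < y < 1}` (chart `x = uv`, `y = v`) lie
on the exceptional divisor `E` of the blow-up of `(u,v) = (1,1)` (residue `t₁₂+t₁₃+t₂₃`).  Both
corner charts have the same bilinear divisors `ξ, η, 1-ξη, 1-η, 1+ξ-ξη` (`α = 1`, `β = 1/2`):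

* C3, vertex `E ∩ {u = 1}`, chart `u = 1-ξη`, `v = 1-η`, residues
  `t₁₂, t₁₂+t₁₃+t₂₃, t₀₁, t₀₁+t₀₂+t₁₂, t₁₃`;
* C4, vertex `E ∩ {v = 1}`, chart `v = 1-ξη`, `u = 1-η`, residues
  `t₂₃, t₁₂+t₁₃+t₂₃, t₀₁+t₀₂+t₁₂, t₀₁, t₁₃`.

This file: their algebra in `U𝔞₄ ⊗ S/(deg > N)` (commutation of the edge residues, flatness and
edge centralities with free letter densities — everything reduces to the infinitesimal braid
relations `rel_A … rel_G` of the cubical charts — integer residue tables), regularity of the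
divisors on the closed chart `[0,1] × [0,1/2]`, closed forms and edge values of the densities
`f_k = ∂_ξ log φ_k`, `g_k = ∂_η log φ_k`, and the two rows of poles `0, -1, 2` and `0, 2, -2` met on
the sides of length `1`.

References: [Drinfeld1991, §2], [Furusho2011, §2], [KontsevichZagier2001, §1.1].
-/

noncomputable section

open Literature.NumberTheory.Transcendental

namespace Summit.KontsevichZagierPeriods.FurushoPentagon.PentagonInKZ

namespace CornersBlowup

open DrinfeldKohnoTrunc CornersCubical

variable {S : Type} [CommRing S] {N : ℕ}

section C3Z -- chart C3: exceptional vertex `E ∩ {u=1}`, `u = 1-ξη`, `v = 1-η`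

/-- `Z₀ Z₁ = Z₁ Z₀` for chart C3. [cite: Drinfeld1991, §2] -/
theorem comm01_C3 (Z : Fin 5 → DrinfeldKohnoTrunc S (Fin 4) N)
    (hZ : Z = ![t S N 1 2, t S N 1 2 + t S N 1 3 + t S N 2 3, t S N 0 1,
      t S N 0 1 + t S N 0 2 + t S N 1 2, t S N 1 3]) :
    Z 0 * Z 1 = Z 1 * Z 0 := by
  subst hZ
  simp only [Matrix.cons_val_zero, Matrix.cons_val_one]
  rw [← sub_eq_zero, ← rel_E (S := S) (N := N)]
  simp only [mul_add, add_mul]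
  abel

/-- Flatness sum of chart C3 with free letter densities. [cite: Drinfeld1991, §2] -/
theorem flat_C3 (Z : Fin 5 → DrinfeldKohnoTrunc S (Fin 4) N)
    (hZ : Z = ![t S N 1 2, t S N 1 2 + t S N 1 3 + t S N 2 3, t S N 0 1,
      t S N 0 1 + t S N 0 2 + t S N 1 2, t S N 1 3])
    (F G : Fin 5 → S) (hF1 : F 1 = 0) (hF3 : F 3 = 0) (hG0 : G 0 = 0)
    (h1 : F 0 * G 2 = F 2 * G 1) (h2 : F 0 * G 4 = F 4 * G 3)
    (h3 : F 4 * G 2 = F 2 * G 1 + F 2 * G 4 - F 4 * G 3) :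
    ∑ k : Fin 5, ∑ l : Fin 5, (F k * G l) • (Z k * Z l - Z l * Z k) = 0 := by
  subst hZ; simp only [Fin.sum_univ_five]
  simp only [Matrix.cons_val_zero, Matrix.cons_val_one, Matrix.head_cons, Matrix.cons_val_two,
    Matrix.tail_cons, Matrix.cons_val_three, Matrix.cons_val_four, hF1, hF3, hG0, zero_mul,
    mul_zero, zero_smul, add_zero, zero_add, sub_self, smul_zero, h1, h2, h3]
  linear_combination (norm := skip) (F 0 * G 1) • (rel_E (S := S) (N := N))
    + (F 0 * G 3) • (rel_D (S := S) (N := N))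
    + (F 2 * G 1) • (rel_C (S := S) (N := N))
    + (F 2 * G 3) • (rel_B (S := S) (N := N))
    + (F 4 * G 1) • (rel_F (S := S) (N := N))
    + (F 4 * G 3) • (rel_A (S := S) (N := N))
  simp only [smul_add, smul_sub, add_smul, sub_smul, smul_zero, mul_add, add_mul]
  abel

/-- Centrality of `Z₀` on the edge `ξ = 0` for chart C3 (free densities).
[cite: Drinfeld1991, §2] -/
theorem central0_C3 (Z : Fin 5 → DrinfeldKohnoTrunc S (Fin 4) N)
    (hZ : Z = ![t S N 1 2, t S N 1 2 + t S N 1 3 + t S N 2 3, t S N 0 1,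
      t S N 0 1 + t S N 0 2 + t S N 1 2, t S N 1 3])
    (G : Fin 5 → S) (hG0 : G 0 = 0) (hG2 : G 2 = 0) (hG4 : G 4 = 0) :
    ∑ l : Fin 5, G l • (Z 0 * Z l - Z l * Z 0) = 0 := by
  subst hZ; simp only [Fin.sum_univ_five]
  simp only [Matrix.cons_val_zero, Matrix.cons_val_one, Matrix.head_cons, Matrix.cons_val_two,
    Matrix.tail_cons, Matrix.cons_val_three, Matrix.cons_val_four, hG0, hG2, hG4, zero_smul,
    add_zero, zero_add, sub_self, smul_zero]
  linear_combination (norm := skip) (G 1) • (rel_E (S := S) (N := N))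
    + (G 3) • (rel_D (S := S) (N := N))
  simp only [smul_add, smul_sub, smul_zero, mul_add, add_mul]
  abel

/-- Centrality of `Z₁` on the edge `η = 0` for chart C3 (free densities).
[cite: Drinfeld1991, §2] -/
theorem central1_C3 (Z : Fin 5 → DrinfeldKohnoTrunc S (Fin 4) N)
    (hZ : Z = ![t S N 1 2, t S N 1 2 + t S N 1 3 + t S N 2 3, t S N 0 1,
      t S N 0 1 + t S N 0 2 + t S N 1 2, t S N 1 3])
    (F : Fin 5 → S) (hF1 : F 1 = 0) (hF2 : F 2 = 0) (hF3 : F 3 = 0) :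
    ∑ k : Fin 5, F k • (Z 1 * Z k - Z k * Z 1) = 0 := by
  subst hZ; simp only [Fin.sum_univ_five]
  simp only [Matrix.cons_val_zero, Matrix.cons_val_one, Matrix.head_cons, Matrix.cons_val_two,
    Matrix.tail_cons, Matrix.cons_val_three, Matrix.cons_val_four, hF1, hF2, hF3, zero_smul,
    add_zero, sub_self, smul_zero]
  linear_combination (norm := skip) (-(F 0)) • (rel_E (S := S) (N := N))
    + (-(F 4)) • (rel_F (S := S) (N := N))
  simp only [smul_add, smul_sub, smul_zero, mul_add, add_mul, neg_smul]
  abel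

/-- The residues of chart C3 as integer combinations of the `t_ij`. [cite: Drinfeld1991, §2] -/
theorem sum_nZ_C3 (Z : Fin 5 → DrinfeldKohnoTrunc S (Fin 4) N)
    (hZ : Z = ![t S N 1 2, t S N 1 2 + t S N 1 3 + t S N 2 3, t S N 0 1,
      t S N 0 1 + t S N 0 2 + t S N 1 2, t S N 1 3])
    (k : Fin 5) :
    ∑ i : Fin 4, ∑ j : Fin 4, (((![![![0, 0, 0, 0], ![0, 0, 1, 0], ![0, 0, 0, 0], ![0, 0, 0, 0]],
      ![![0, 0, 0, 0], ![0, 0, 1, 1], ![0, 0, 0, 1], ![0, 0, 0, 0]],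
      ![![0, 1, 0, 0], ![0, 0, 0, 0], ![0, 0, 0, 0], ![0, 0, 0, 0]],
      ![![0, 1, 1, 0], ![0, 0, 1, 0], ![0, 0, 0, 0], ![0, 0, 0, 0]],
      ![![0, 0, 0, 0], ![0, 0, 0, 1], ![0, 0, 0, 0], ![0, 0, 0, 0]]] :
        Fin 5 → Fin 4 → Fin 4 → ℤ) k i j : ℤ) : S) • t S N i j = Z k := by
  subst hZ
  fin_cases k <;> simp [Fin.sum_univ_four, add_assoc]

end C3Z

section C4Z -- chart C4: exceptional vertex `E ∩ {v=1}`, `v = 1-ξη`, `u = 1-η`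

/-- `Z₀ Z₁ = Z₁ Z₀` for chart C4. [cite: Drinfeld1991, §2] -/
theorem comm01_C4 (Z : Fin 5 → DrinfeldKohnoTrunc S (Fin 4) N)
    (hZ : Z = ![t S N 2 3, t S N 1 2 + t S N 1 3 + t S N 2 3, t S N 0 1 + t S N 0 2 + t S N 1 2,
      t S N 0 1, t S N 1 3]) :
    Z 0 * Z 1 = Z 1 * Z 0 := by
  subst hZ
  simp only [Matrix.cons_val_zero, Matrix.cons_val_one]
  rw [← sub_eq_zero, ← neg_eq_zero, ← rel_G (S := S) (N := N)]
  simp only [mul_add, add_mul]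
  abel

/-- Flatness sum of chart C4 with free letter densities. [cite: Drinfeld1991, §2] -/
theorem flat_C4 (Z : Fin 5 → DrinfeldKohnoTrunc S (Fin 4) N)
    (hZ : Z = ![t S N 2 3, t S N 1 2 + t S N 1 3 + t S N 2 3, t S N 0 1 + t S N 0 2 + t S N 1 2,
      t S N 0 1, t S N 1 3])
    (F G : Fin 5 → S) (hF1 : F 1 = 0) (hF3 : F 3 = 0) (hG0 : G 0 = 0)
    (h1 : F 0 * G 2 = F 2 * G 1) (h2 : F 0 * G 4 = F 4 * G 3)
    (h3 : F 4 * G 2 = F 2 * G 1 + F 2 * G 4 - F 4 * G 3) :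
    ∑ k : Fin 5, ∑ l : Fin 5, (F k * G l) • (Z k * Z l - Z l * Z k) = 0 := by
  subst hZ; simp only [Fin.sum_univ_five]
  simp only [Matrix.cons_val_zero, Matrix.cons_val_one, Matrix.head_cons, Matrix.cons_val_two,
    Matrix.tail_cons, Matrix.cons_val_three, Matrix.cons_val_four, hF1, hF3, hG0, zero_mul,
    mul_zero, zero_smul, add_zero, zero_add, sub_self, smul_zero, h1, h2, h3]
  linear_combination (norm := skip) (-(F 0 * G 1)) • (rel_G (S := S) (N := N))
    + (-(F 0 * G 3)) • (rel_C (S := S) (N := N))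
    + (-(F 2 * G 1)) • (rel_D (S := S) (N := N))
    + (-(F 2 * G 3)) • (rel_B (S := S) (N := N))
    + (F 4 * G 1) • (rel_F (S := S) (N := N))
    + (-(F 4 * G 3)) • (rel_A (S := S) (N := N))
    + (-(F 4 * G 3)) • (rel_F (S := S) (N := N))
  simp only [smul_add, smul_sub, add_smul, sub_smul, smul_zero, mul_add, add_mul, neg_smul]
  abel

/-- Centrality of `Z₀` on the edge `ξ = 0` for chart C4 (free densities).
[cite: Drinfeld1991, §2] -/
theorem central0_C4 (Z : Fin 5 → DrinfeldKohnoTrunc S (Fin 4) N)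
    (hZ : Z = ![t S N 2 3, t S N 1 2 + t S N 1 3 + t S N 2 3, t S N 0 1 + t S N 0 2 + t S N 1 2,
      t S N 0 1, t S N 1 3])
    (G : Fin 5 → S) (hG0 : G 0 = 0) (hG2 : G 2 = 0) (hG4 : G 4 = 0) :
    ∑ l : Fin 5, G l • (Z 0 * Z l - Z l * Z 0) = 0 := by
  subst hZ; simp only [Fin.sum_univ_five]
  simp only [Matrix.cons_val_zero, Matrix.cons_val_one, Matrix.head_cons, Matrix.cons_val_two,
    Matrix.tail_cons, Matrix.cons_val_three, Matrix.cons_val_four, hG0, hG2, hG4, zero_smul,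
    add_zero, zero_add, sub_self, smul_zero]
  linear_combination (norm := skip) (-(G 1)) • (rel_G (S := S) (N := N))
    + (-(G 3)) • (rel_C (S := S) (N := N))
  simp only [smul_add, smul_sub, smul_zero, mul_add, add_mul, neg_smul]
  abel

/-- Centrality of `Z₁` on the edge `η = 0` for chart C4 (free densities).
[cite: Drinfeld1991, §2] -/
theorem central1_C4 (Z : Fin 5 → DrinfeldKohnoTrunc S (Fin 4) N)
    (hZ : Z = ![t S N 2 3, t S N 1 2 + t S N 1 3 + t S N 2 3, t S N 0 1 + t S N 0 2 + t S N 1 2,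
      t S N 0 1, t S N 1 3])
    (F : Fin 5 → S) (hF1 : F 1 = 0) (hF2 : F 2 = 0) (hF3 : F 3 = 0) :
    ∑ k : Fin 5, F k • (Z 1 * Z k - Z k * Z 1) = 0 := by
  subst hZ; simp only [Fin.sum_univ_five]
  simp only [Matrix.cons_val_zero, Matrix.cons_val_one, Matrix.head_cons, Matrix.cons_val_two,
    Matrix.tail_cons, Matrix.cons_val_three, Matrix.cons_val_four, hF1, hF2, hF3, zero_smul,
    add_zero, sub_self, smul_zero]
  linear_combination (norm := skip) (F 0) • (rel_G (S := S) (N := N))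
    + (-(F 4)) • (rel_F (S := S) (N := N))
  simp only [smul_add, smul_sub, smul_zero, mul_add, add_mul, neg_smul]
  abel

/-- The residues of chart C4 as integer combinations of the `t_ij`. [cite: Drinfeld1991, §2] -/
theorem sum_nZ_C4 (Z : Fin 5 → DrinfeldKohnoTrunc S (Fin 4) N)
    (hZ : Z = ![t S N 2 3, t S N 1 2 + t S N 1 3 + t S N 2 3, t S N 0 1 + t S N 0 2 + t S N 1 2,
      t S N 0 1, t S N 1 3])
    (k : Fin 5) :
    ∑ i : Fin 4, ∑ j : Fin 4, (((![![![0, 0, 0, 0], ![0, 0, 0, 0], ![0, 0, 0, 1], ![0, 0, 0, 0]],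
      ![![0, 0, 0, 0], ![0, 0, 1, 1], ![0, 0, 0, 1], ![0, 0, 0, 0]],
      ![![0, 1, 1, 0], ![0, 0, 1, 0], ![0, 0, 0, 0], ![0, 0, 0, 0]],
      ![![0, 1, 0, 0], ![0, 0, 0, 0], ![0, 0, 0, 0], ![0, 0, 0, 0]],
      ![![0, 0, 0, 0], ![0, 0, 0, 1], ![0, 0, 0, 0], ![0, 0, 0, 0]]] :
        Fin 5 → Fin 4 → Fin 4 → ℤ) k i j : ℤ) : S) • t S N i j = Z k := by
  subst hZ
  fin_cases k <;> simp [Fin.sum_univ_four, add_assoc]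

end C4Z


section Bcf -- the common divisors of the two blow-up charts

variable (cf : Fin 5 → Fin 4 → ℚ)
  (hcf : cf = ![![0, 1, 0, 0], ![0, 0, 1, 0], ![1, 0, 0, -1], ![1, 0, -1, 0], ![1, 1, 0, -1]])

include hcf in
/-- The divisors `1-ξη`, `1-η`, `1+ξ-ξη` of the blow-up charts do not vanish on the closed chart
`[0, 1] × [0, 1/2]`. [folklore] -/
theorem hreg_B (φ : Fin 5 → ℝ → ℝ → ℝ)
    (hφ : ∀ k x y, φ k x y = cf k 0 + cf k 1 * x + cf k 2 * y + cf k 3 * x * y) :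
    ∀ k : Fin 5, k ≠ 0 → k ≠ 1 → ∀ x y : ℝ, 0 ≤ x → x ≤ ((1 : ℚ) : ℝ) → 0 ≤ y →
      y ≤ ((1 / 2 : ℚ) : ℝ) → φ k x y ≠ 0 := by
  subst hcf
  intro k hk0 hk1 x y hx0 hx1 hy0 hy1
  have h2 : ((1 / 2 : ℚ) : ℝ) = 1 / 2 := by norm_num
  rw [h2] at hy1
  rw [Rat.cast_one] at hx1
  fin_cases k
  · exact absurd rfl hk0
  · exact absurd rfl hk1
  · rw [hφ]; simp; nlinarith [mul_le_mul hx1 hy1 hy0 (by norm_num : (0:ℝ) ≤ 1)]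
  · rw [hφ]; simp; nlinarith
  · rw [hφ]; simp; nlinarith [mul_nonneg hx0 (by linarith : (0:ℝ) ≤ 1 - y)]

include hcf in
/-- Closed forms of the letter densities `f_k = ∂_ξ log φ_k`, `g_k = ∂_η log φ_k` of the blow-up
charts. [folklore] -/
theorem fg_B (φ f g : Fin 5 → ℝ → ℝ → ℝ)
    (hφ : ∀ k x y, φ k x y = cf k 0 + cf k 1 * x + cf k 2 * y + cf k 3 * x * y)
    (hf : ∀ k x y, f k x y = (cf k 1 + cf k 3 * y) / φ k x y)
    (hg : ∀ k x y, g k x y = (cf k 2 + cf k 3 * x) / φ k x y) (x y : ℝ) :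
    (f 0 x y = 1 / x ∧ f 1 x y = 0 ∧ f 2 x y = -y / (1 - x * y) ∧ f 3 x y = 0 ∧
      f 4 x y = (1 - y) / (1 + x - x * y)) ∧
    (g 0 x y = 0 ∧ g 1 x y = 1 / y ∧ g 2 x y = -x / (1 - x * y) ∧ g 3 x y = -1 / (1 - y) ∧
      g 4 x y = -x / (1 + x - x * y)) := by
  subst hcf
  refine ⟨⟨?_, ?_, ?_, ?_, ?_⟩, ?_, ?_, ?_, ?_, ?_⟩ <;>
  simp only [hf, hg, hφ, Matrix.cons_val_zero, Matrix.cons_val_one, Matrix.head_cons,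
    Matrix.cons_val_two, Matrix.tail_cons, Matrix.cons_val_three, Matrix.cons_val_four] <;>
  push_cast <;> ring

end Bcf

/-- Edge values of the letter densities of the blow-up charts on the four sides `η = 0`,
`η = 1/2` (`ξ ∈ (0,1)`), `ξ = 0`, `ξ = 1` (`η ∈ (0,1/2)`): a density is `0` or `1/(t - pole)`,
pole `∈ {0, -1, 2, -2, 1}`. [folklore] -/
theorem edge_B (f g : Fin 5 → ℝ → ℝ → ℝ)
    (hfg : ∀ x y : ℝ, (f 0 x y = 1 / x ∧ f 1 x y = 0 ∧ f 2 x y = -y / (1 - x * y) ∧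
      f 3 x y = 0 ∧ f 4 x y = (1 - y) / (1 + x - x * y)) ∧
    (g 0 x y = 0 ∧ g 1 x y = 1 / y ∧ g 2 x y = -x / (1 - x * y) ∧ g 3 x y = -1 / (1 - y) ∧
      g 4 x y = -x / (1 + x - x * y))) (t : ℝ) :
    (f 0 t 0 = t⁻¹ ∧ f 1 t 0 = 0 ∧ f 2 t 0 = 0 ∧ f 3 t 0 = 0 ∧ f 4 t 0 = (t - (-1))⁻¹) ∧
    (f 0 t 2⁻¹ = t⁻¹ ∧ f 1 t 2⁻¹ = 0 ∧ f 2 t 2⁻¹ = (t - 2)⁻¹ ∧ f 3 t 2⁻¹ = 0 ∧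
      f 4 t 2⁻¹ = (t - (-2))⁻¹) ∧
    (g 0 0 t = 0 ∧ g 1 0 t = t⁻¹ ∧ g 2 0 t = 0 ∧ g 3 0 t = (t - 1)⁻¹ ∧ g 4 0 t = 0) ∧
    (g 0 1 t = 0 ∧ g 1 1 t = t⁻¹ ∧ g 2 1 t = (t - 1)⁻¹ ∧ g 3 1 t = (t - 1)⁻¹ ∧
      g 4 1 t = (t - 2)⁻¹) := by
  obtain ⟨⟨a0, a1, a2, a3, a4⟩, -⟩ := hfg t 0
  obtain ⟨⟨b0, b1, b2, b3, b4⟩, -⟩ := hfg t 2⁻¹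
  obtain ⟨-, c0, c1, c2, c3, c4⟩ := hfg 0 t
  obtain ⟨-, d0, d1, d2, d3, d4⟩ := hfg 1 t
  refine ⟨⟨by rw [a0, one_div], a1, by rw [a2]; simp, a3, ?_⟩,
    ⟨by rw [b0, one_div], b1, ?_, b3, ?_⟩,
    ⟨c0, by rw [c1, one_div], by rw [c2]; simp, by rw [c3, neg_one_div_one_sub], by rw [c4]; simp⟩,
    ⟨d0, by rw [d1, one_div], ?_, by rw [d3, neg_one_div_one_sub], ?_⟩⟩
  · rw [a4, show (1 : ℝ) - 0 = 1 by norm_num, show (1 : ℝ) + t - t * 0 = 1 * (t - (-1)) by ring]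
    exact div_mul_left_eq_inv (by norm_num) _
  · rw [b2, show (1 : ℝ) - t * 2⁻¹ = -2⁻¹ * (t - 2) by ring]
    exact div_mul_left_eq_inv (by norm_num) _
  · rw [b4, show (1 : ℝ) - 2⁻¹ = 2⁻¹ by norm_num,
      show (1 : ℝ) + t - t * 2⁻¹ = 2⁻¹ * (t - (-2)) by ring]
    exact div_mul_left_eq_inv (by norm_num) _
  · rw [d2, show (1 : ℝ) - 1 * t = -1 * (t - 1) by ring]
    exact div_mul_left_eq_inv (by norm_num) _
  · rw [d4, show (1 : ℝ) + 1 - 1 * t = -1 * (t - 2) by ring]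
    exact div_mul_left_eq_inv (by norm_num) _

/-! ### Rows of poles met by the blow-up charts -/

/-- Poles `0, -1, 2` (atlas row of the paths `10, 11`): rational, nonzero off the letter `0`,
separated from `(0, 1)`. [folklore] -/
theorem poles_0m2 :
    (∀ b : Fin 3, ∃ q : ℚ, (![0, -1, 2] : Fin 3 → ℝ) b = q) ∧
    (∀ b : Fin 3, b ≠ 0 → (![0, -1, 2] : Fin 3 → ℝ) b ≠ 0) ∧
    (∀ b : Fin 3, (![0, -1, 2] : Fin 3 → ℝ) b = 0 ∨
      ∀ s : ℝ, 0 < s → s < ((1 : ℚ) : ℝ) → 2⁻¹ ≤ |s - (![0, -1, 2] : Fin 3 → ℝ) b|) := by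
  refine ⟨fun b => ?_, fun b hb => ?_, fun b => ?_⟩
  · fin_cases b
    · exact ⟨0, by simp⟩
    · exact ⟨-1, by simp⟩
    · exact ⟨2, by simp⟩
  · fin_cases b
    · exact absurd rfl hb
    · simp
    · simp
  · fin_cases b
    · exact Or.inl (by simp)
    · refine Or.inr fun s h0 h1 => ?_
      change 2⁻¹ ≤ |s - (-1)|
      exact le_abs.2 (Or.inl (by linarith))
    · refine Or.inr fun s h0 h1 => ?_
      rw [Rat.cast_one] at h1
      change 2⁻¹ ≤ |s - 2|
      exact le_abs.2 (Or.inr (by linarith))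

/-- Poles `0, 2, -2` (the side `η = 1/2` of the blow-up charts, before rescaling): rational,
nonzero off the letter `0`, separated from `(0, 1)`. [folklore] -/
theorem poles_02m :
    (∀ b : Fin 3, ∃ q : ℚ, (![0, 2, -2] : Fin 3 → ℝ) b = q) ∧
    (∀ b : Fin 3, b ≠ 0 → (![0, 2, -2] : Fin 3 → ℝ) b ≠ 0) ∧
    (∀ b : Fin 3, (![0, 2, -2] : Fin 3 → ℝ) b = 0 ∨
      ∀ s : ℝ, 0 < s → s < ((1 : ℚ) : ℝ) → 2⁻¹ ≤ |s - (![0, 2, -2] : Fin 3 → ℝ) b|) := by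
  refine ⟨fun b => ?_, fun b hb => ?_, fun b => ?_⟩
  · fin_cases b
    · exact ⟨0, by simp⟩
    · exact ⟨2, by simp⟩
    · exact ⟨-2, by simp⟩
  · fin_cases b
    · exact absurd rfl hb
    · simp
    · simp
  · fin_cases b
    · exact Or.inl (by simp)
    · refine Or.inr fun s h0 h1 => ?_
      rw [Rat.cast_one] at h1
      change 2⁻¹ ≤ |s - 2|
      exact le_abs.2 (Or.inr (by linarith))
    · refine Or.inr fun s h0 h1 => ?_
      change 2⁻¹ ≤ |s - (-2)|
      exact le_abs.2 (Or.inl (by linarith))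

end CornersBlowup

/-- **Sub-stub `cornersBlowup_flatC3` of `stub_cornersBlowup`**: flatness
`Σ_{k,l} f_k g_l [Z_k, Z_l] = 0` of the KZ-type connection of the blow-up corner chart C3
(exceptional vertex `E ∩ {u = 1}` of the pentagon cell; residues
`t₁₂, t₁₂+t₁₃+t₂₃, t₀₁, t₀₁+t₀₂+t₁₂, t₁₃`) in `U𝔞₄ ⊗ S/(deg > N)`, for free letter densities
subject to the three scalar identities of the chart. [cite: Drinfeld1991, §2] -/
theorem cornersBlowup_flatC3 :
    ∀ (S : Type) [CommRing S] (N : ℕ) (Z : Fin 5 → DrinfeldKohnoTrunc S (Fin 4) N), Z = ![DrinfeldKohnoTrunc.t S N 1 2, DrinfeldKohnoTrunc.t S N 1 2 + DrinfeldKohnoTrunc.t S N 1 3 + DrinfeldKohnoTrunc.t S N 2 3, DrinfeldKohnoTrunc.t S N 0 1, DrinfeldKohnoTrunc.t S N 0 1 + DrinfeldKohnoTrunc.t S N 0 2 + DrinfeldKohnoTrunc.t S N 1 2, DrinfeldKohnoTrunc.t S N 1 3] → ∀ (F G : Fin 5 → S), F 1 = 0 → F 3 = 0 → G 0 = 0 →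 F 0 * G 2 = F 2 * G 1 → F 0 * G 4 = F 4 * G 3 → F 4 * G 2 = F 2 * G 1 + F 2 * G 4 - F 4 * G 3 → ∑ k : Fin 5, ∑ l : Fin 5, (F k * G l) • (Z k * Z l - Z l * Z k) = 0 := by
  intro S _ N Z hZ F G hF1 hF3 hG0 h1 h2 h3
  exact CornersBlowup.flat_C3 Z hZ F G hF1 hF3 hG0 h1 h2 h3

end Summit.KontsevichZagierPeriods.FurushoPentagon.PentagonInKZ
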